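import Summits.Ventures.LatticeQCDFlow.Scaling.FlowHubModeGap

/-!
HONEST FRAMING: exact (Metropolis-corrected) sampling algorithms for lattice gauge theory; figures
of merit are autocorrelation/cost numbers at stated couplings and volumes; no continuum-physics
claim.

# HubModeTransport — WHAT A SECTOR-PRESERVING MAP MUST DO ON THE HUB: IF THE TRANSPORTED COLD CONDITIONAL LAW COVERS
# THE HOT CONDITIONAL LAW UP TO `ρ` ON EVERY SECTOR (`ρ·μ_0(u|A_j) ≤ (μ_{k+1}∘φ_k)(u|A_j)`), THE ASSIGNMENT-RESTRICTED
# HUB-SWAP ACCEPTANCE IS AT LEAST `ρ` (`= 1` FOR PERFECT SECTOR-WISE CONDITIONAL TRANSPORTS), SO THE BALANCED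
# MAP-ASSISTED STAR HAS `Gap ≥ p(1−t)γ_A·min{tρ, γ₀(1−t)}/(224K²)` — THE SECTOR WEIGHTS MAY DIFFER ARBITRARILY BETWEEN
# HOT AND COLD (`p`), THE SHAPES ARE THE MAP'S JOB (`ρ`); ONE-SIDED IN BOTH (lean-2 GEN-22, ours)

Venture-side (OURS).  Cell `lqcd-flow` (pub-lqcd), unit `pub-lqcd-lean-2-g22`, 2026-08-26.  Chapter J, file 5: the
hypothesis `hδ` of `Scaling/HubModeGap` / `Scaling/FlowHubModeGap` (J3/J4) — the assignment-restricted hub-swap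
overlap `δ₂·min{π̄(i), π̄(i∘τ_k)} ≤ Σ_{x∈B_i} min{π̃(x), π̃(x∘τ_k)}`, a statement about pairs of whole replica
configurations — reduced to ONE-LEVEL, ONE-SIDED data: a COVERING RATIO `ρ` of the hot conditional law by the cold
(resp. transported cold) conditional law on each sector, `ρ·μ_0(u)·ν_{k+1}(A_j) ≤ μ_{k+1}(u)·ν_0(A_j)` for `u ∈ A_j`
(`ν_l(A_j) = μ_l(A_j)` the sector weights).  The pointwise step: for `x ∈ B_i` both `π̃(x)` and `π̃(x∘τ_k)` dominate
`ρ·G(x)·`(a sector-weight ratio), where `G = ⊗f`, `f = μ` with the cold law at position `k+1` replaced by the HOT law;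
`G` is a pure tensor, summed over the block by `blockMass_tensorFun_modes`.  The hub counterpart of
`Scaling/ReplicaExchangeModeOverlap` (R5, adjacent ladder: `δ₂ = δ²pq` from two-sided one-level overlaps); here one
factor `ρ`, one-sided, and the sector weights never enter `δ₂` (they enter J3 only through the persistence `p`).

## What is proved

* §1 `tensorFun_hotAt_mul` (`⊗f(x)·μ_{k+1}(x_{k+1}) = π̃(x)·μ_0(x_{k+1})`);
  **`hubModeOverlap_of_cover`** — the covering ratio `ρ` gives `hδ` of J3 with `δ₂ = ρ` (identity maps).
* §2 **`flowHubModeOverlap_of_cover`** — for sector-preserving `φ_k` with TRANSPORTED covering ratio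
  `ρ·μ_0(u)·ν_{k+1}(A_{mode u}) ≤ μ_{k+1}(φ_k u)·ν_0(A_{mode u})`: `hδ` of J4 with `δ₂ = ρ`.
* §3 **`flowHubModeCover_spectralGap_ge`** — balanced map-assisted star: `Gap ≥ p(1−t)γ_A·min{tρ, γ₀(1−t)}/(224K²)`;
  **`flowHubModePerfect_spectralGap_ge`** — perfect sector-wise conditional transports
  (`μ_{k+1}(φ_k u)·ν_0(A_j) = μ_0(u)·ν_{k+1}(A_j)`): `Gap ≥ p(1−t)γ_A·min{t, γ₀(1−t)}/(224K²)` for ARBITRARY cold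
  conditional shapes; **`flowHubModeCover_tauInt_le`** (`τ_int(g) ≤ 224K²/(p(1−t)γ_A·min{tρ, γ₀(1−t)}) − ½`).

Reading (no numerics implied): on the hub a learned sector-preserving map has exactly one job — carry each sector's
hot conditional law onto the same sector's cold conditional law; the sector WEIGHTS it cannot touch, and they cost
only the heating persistence `p`; with that job done the exact sampler over `K` arbitrarily metastable cold levels
relaxes in order `K²/(pγ_Aγ₀)` steps.  NOT CLAIMED: maps that move weight between sectors; sharpness of `ρ`;
continuous configuration spaces; anything measured.  Literature grade (cell rule): ELEMENTARY + the tree's level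
coordinates, NEW TYPING; nothing cited as a fact; no new bib keys.
-/

noncomputable section

open Finset Function
open Literature.Probability.MarkovChains
open Literature.Probability.MarkovChains.Decomposition

namespace Summit.Ventures.LatticeQCDFlow.Scaling

section Cover

variable {S J : Type*} [Fintype S] [DecidableEq S] [Fintype J] [DecidableEq J] {K : ℕ}
  {μ : Fin (K + 1) → S → ℝ} {M : Fin (K + 1) → S → S → ℝ} {mode : S → J} {t : ℝ}

/-! ## §1 The covering ratio gives the assignment-restricted hub-swap overlap -/

omit [DecidableEq S] [Fintype J] [DecidableEq J] in
/-- **Replacing the cold law at position `k+1` by the hot law:** `⊗f(x)·μ_{k+1}(x_{k+1}) = π̃(x)·μ_0(x_{k+1})` for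
`f_l = μ_l` (`l ≠ k+1`), `f_{k+1} = μ_0`. [ours] -/
theorem tensorFun_hotAt_mul {X : Type*} (μ : Fin (K + 1) → X → ℝ) (k : Fin K) (x : Fin (K + 1) → X) :
    tensorFun (fun l => if l = k.succ then μ 0 else μ l) x * μ k.succ (x k.succ) = tensorFun μ x * μ 0 (x k.succ) := by
  unfold tensorFun
  rw [← Finset.mul_prod_erase univ (fun l => (if l = k.succ then μ 0 else μ l) (x l)) (mem_univ k.succ),
    ← Finset.mul_prod_erase univ (fun l => μ l (x l)) (mem_univ k.succ)]
  have h : ∏ l ∈ univ.erase k.succ, (if l = k.succ then μ 0 else μ l) (x l) = ∏ l ∈ univ.erase k.succ, μ l (x l) :=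
    prod_congr rfl fun l hl => by rw [if_neg (ne_of_mem_erase hl)]
  rw [h, if_pos rfl]
  ring

omit [DecidableEq S] [Fintype J] in
/-- **THE COVERING RATIO GIVES THE HUB-SWAP OVERLAP:** if on every sector the cold conditional law covers the hot one up
to `ρ ≥ 0` — `ρ·μ_0(u)·μ_{k+1}(A_{mode u}) ≤ μ_{k+1}(u)·μ_0(A_{mode u})` for all `k`, `u` — then for every assignment
`i` and hub position `k+1`: `ρ·min{π̃(B_i), π̃(B_{i∘τ_k})} ≤ Σ_{x∈B_i} min{π̃(x), π̃(x∘τ_k)}` (`μ_k > 0`, `mode` onto).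
[ours] -/
theorem hubModeOverlap_of_cover (hμ : ∀ k x, 0 < μ k x) (hmode : Function.Surjective mode) {ρ : ℝ} (hρ : 0 ≤ ρ)
    (hcov : ∀ (k : Fin K) (u : S),
      ρ * (μ 0 u * blockMass (μ k.succ) mode (mode u)) ≤ μ k.succ u * blockMass (μ 0) mode (mode u))
    (i : Fin (K + 1) → J) (k : Fin K) :
    ρ * min (blockMass (tensorFun μ) (fun z : Fin (K + 1) → S => mode ∘ z) i)
        (blockMass (tensorFun μ) (fun z : Fin (K + 1) → S => mode ∘ z) (i ∘ Equiv.swap (0 : Fin (K + 1)) k.succ))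
      ≤ ∑ x ∈ block (fun z : Fin (K + 1) → S => mode ∘ z) i,
          min (tensorFun μ x) (tensorFun μ (x ∘ Equiv.swap (0 : Fin (K + 1)) k.succ)) := by
  set ν : Fin (K + 1) → J → ℝ := fun l => blockMass (μ l) mode with hν
  set f : Fin (K + 1) → S → ℝ := fun l => if l = k.succ then μ 0 else μ l with hf
  have hν0 : ∀ l j, 0 < ν l j := fun l j => blockMass_pos (hμ l) hmode j
  have hπ0 : ∀ x, 0 ≤ tensorFun μ x := fun x => (tensorFun_pos hμ x).le
  have hf0 : ∀ l u, 0 < f l u := fun l u => by rw [hf]; beta_reduce; split_ifs <;> exact hμ _ _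
  have hG0 : ∀ x, 0 ≤ tensorFun f x := fun x => (tensorFun_pos hf0 x).le
  rw [ptBareMode_blockMass i, ptBareMode_blockMass (i ∘ Equiv.swap (0 : Fin (K + 1)) k.succ)]
  change ρ * min (tensorFun ν i) (tensorFun ν (i ∘ Equiv.swap (0 : Fin (K + 1)) k.succ)) ≤ _
  set W := tensorFun ν i with hW
  set W' := tensorFun ν (i ∘ Equiv.swap (0 : Fin (K + 1)) k.succ) with hW'
  set n00 := ν 0 (i 0) * ν 0 (i k.succ) with hn00
  set m₁ := min (ν k.succ (i k.succ) * ν 0 (i 0)) (ν k.succ (i 0) * ν 0 (i k.succ)) with hm₁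
  have hn00pos : 0 < n00 := mul_pos (hν0 _ _) (hν0 _ _)
  -- pointwise on the block
  have hpt : ∀ x ∈ block (fun z : Fin (K + 1) → S => mode ∘ z) i,
      ρ * tensorFun f x * m₁ ≤ min (tensorFun μ x) (tensorFun μ (x ∘ Equiv.swap (0 : Fin (K + 1)) k.succ)) * n00 := by
    intro x hx
    have hxm : mode ∘ x = i := mem_block.mp hx
    have hm0 : mode (x 0) = i 0 := congrFun hxm 0
    have hmk : mode (x k.succ) = i k.succ := congrFun hxm k.succ
    have eG := tensorFun_hotAt_mul μ k x
    rw [← hf] at eG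
    -- (P1) `ρ·G·ν_{k+1}(i_{k+1}) ≤ π̃(x)·ν_0(i_{k+1})`
    have P1 : ρ * tensorFun f x * ν k.succ (i k.succ) ≤ tensorFun μ x * ν 0 (i k.succ) := by
      have hc := hcov k (x k.succ)
      rw [hmk] at hc
      refine le_of_mul_le_mul_right ?_ (hμ k.succ (x k.succ))
      calc ρ * tensorFun f x * ν k.succ (i k.succ) * μ k.succ (x k.succ)
          = (tensorFun f x * μ k.succ (x k.succ)) * (ρ * ν k.succ (i k.succ)) := by ring
        _ = tensorFun μ x * (ρ * (μ 0 (x k.succ) * ν k.succ (i k.succ))) := by rw [eG]; ring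
        _ ≤ tensorFun μ x * (μ k.succ (x k.succ) * ν 0 (i k.succ)) := mul_le_mul_of_nonneg_left hc (hπ0 x)
        _ = tensorFun μ x * ν 0 (i k.succ) * μ k.succ (x k.succ) := by ring
    -- (P2) `ρ·G·ν_{k+1}(i_0) ≤ π̃(x∘τ_k)·ν_0(i_0)`
    have P2 : ρ * tensorFun f x * ν k.succ (i 0)
        ≤ tensorFun μ (x ∘ Equiv.swap (0 : Fin (K + 1)) k.succ) * ν 0 (i 0) := by
      have hc := hcov k (x 0)
      rw [hm0] at hc
      have eτ := tensorFun_comp_swap_zero_succ_mul μ x k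
      have hpos : 0 < μ 0 (x 0) * μ k.succ (x k.succ) := mul_pos (hμ _ _) (hμ _ _)
      refine le_of_mul_le_mul_right ?_ hpos
      calc ρ * tensorFun f x * ν k.succ (i 0) * (μ 0 (x 0) * μ k.succ (x k.succ))
          = (tensorFun f x * μ k.succ (x k.succ)) * (ρ * ν k.succ (i 0)) * μ 0 (x 0) := by ring
        _ = tensorFun μ x * μ 0 (x k.succ) * (ρ * (μ 0 (x 0) * ν k.succ (i 0))) := by rw [eG]; ring
        _ ≤ tensorFun μ x * μ 0 (x k.succ) * (μ k.succ (x 0) * ν 0 (i 0)) :=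
            mul_le_mul_of_nonneg_left hc (mul_nonneg (hπ0 x) (hμ _ _).le)
        _ = tensorFun μ x * (μ 0 (x k.succ) * μ k.succ (x 0)) * ν 0 (i 0) := by ring
        _ = tensorFun μ (x ∘ Equiv.swap (0 : Fin (K + 1)) k.succ) * (μ 0 (x 0) * μ k.succ (x k.succ)) * ν 0 (i 0) := by
            rw [eτ]
        _ = _ := by ring
    have Q1 : ρ * tensorFun f x * (ν k.succ (i k.succ) * ν 0 (i 0)) ≤ tensorFun μ x * n00 := by
      calc ρ * tensorFun f x * (ν k.succ (i k.succ) * ν 0 (i 0))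
          = (ρ * tensorFun f x * ν k.succ (i k.succ)) * ν 0 (i 0) := by ring
        _ ≤ (tensorFun μ x * ν 0 (i k.succ)) * ν 0 (i 0) := mul_le_mul_of_nonneg_right P1 (hν0 _ _).le
        _ = tensorFun μ x * n00 := by rw [hn00]; ring
    have Q2 : ρ * tensorFun f x * (ν k.succ (i 0) * ν 0 (i k.succ))
        ≤ tensorFun μ (x ∘ Equiv.swap (0 : Fin (K + 1)) k.succ) * n00 := by
      calc ρ * tensorFun f x * (ν k.succ (i 0) * ν 0 (i k.succ))
          = (ρ * tensorFun f x * ν k.succ (i 0)) * ν 0 (i k.succ) := by ring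
        _ ≤ (tensorFun μ (x ∘ Equiv.swap (0 : Fin (K + 1)) k.succ) * ν 0 (i 0)) * ν 0 (i k.succ) :=
            mul_le_mul_of_nonneg_right P2 (hν0 _ _).le
        _ = tensorFun μ (x ∘ Equiv.swap (0 : Fin (K + 1)) k.succ) * n00 := by rw [hn00]; ring
    have hρG : 0 ≤ ρ * tensorFun f x := mul_nonneg hρ (hG0 x)
    rw [hm₁, min_mul_of_nonneg _ _ hn00pos.le, mul_min_of_nonneg _ _ hρG]
    exact min_le_min Q1 Q2
  -- sum over the block: `Σ_{B_i} G = ⊗(hotAt ν)(i)`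
  have hF : ∑ x ∈ block (fun z : Fin (K + 1) → S => mode ∘ z) i, tensorFun f x
      = tensorFun (fun l => if l = k.succ then ν 0 else ν l) i := by
    change blockMass (tensorFun f) (fun z : Fin (K + 1) → S => mode ∘ z) i = _
    rw [blockMass_tensorFun_modes]
    unfold tensorFun
    refine prod_congr rfl fun l _ => ?_
    by_cases hl : l = k.succ
    · subst hl; simp [hf, hν]
    · simp [hf, hν, hl]
  have hFW : tensorFun (fun l => if l = k.succ then ν 0 else ν l) i * ν k.succ (i k.succ) = W * ν 0 (i k.succ) :=
    tensorFun_hotAt_mul ν k i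
  have hWW : W' * (ν 0 (i 0) * ν k.succ (i k.succ)) = W * (ν 0 (i k.succ) * ν k.succ (i 0)) :=
    tensorFun_comp_swap_zero_succ_mul ν i k
  -- `F·m₁ = n00·min{W, W'}` (multiply through by `ν_{k+1}(i_{k+1}) > 0`)
  have hFm : tensorFun (fun l => if l = k.succ then ν 0 else ν l) i * m₁ = n00 * min W W' := by
    refine mul_right_cancel₀ (hν0 k.succ (i k.succ)).ne' ?_
    have hW0 : 0 ≤ W := by rw [hW]; exact prod_nonneg fun l _ => (hν0 _ _).le
    calc tensorFun (fun l => if l = k.succ then ν 0 else ν l) i * m₁ * ν k.succ (i k.succ)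
        = (tensorFun (fun l => if l = k.succ then ν 0 else ν l) i * ν k.succ (i k.succ)) * m₁ := by ring
      _ = W * ν 0 (i k.succ) * m₁ := by rw [hFW]
      _ = min (W * (ν 0 (i k.succ) * ν k.succ (i k.succ) * ν 0 (i 0))) (W * (ν 0 (i k.succ) * ν k.succ (i 0) * ν 0 (i k.succ))) := by
          rw [hm₁, mul_min_of_nonneg _ _ (mul_nonneg hW0 (hν0 _ _).le)]
          congr 1 <;> ring
      _ = min (W * (n00 * ν k.succ (i k.succ))) (W' * (n00 * ν k.succ (i k.succ))) := by
          congr 1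
          · rw [hn00]; ring
          · calc W * (ν 0 (i k.succ) * ν k.succ (i 0) * ν 0 (i k.succ))
                = (W * (ν 0 (i k.succ) * ν k.succ (i 0))) * ν 0 (i k.succ) := by ring
              _ = (W' * (ν 0 (i 0) * ν k.succ (i k.succ))) * ν 0 (i k.succ) := by rw [hWW]
              _ = W' * (n00 * ν k.succ (i k.succ)) := by rw [hn00]; ring
      _ = n00 * min W W' * ν k.succ (i k.succ) := by
          rw [show n00 * min W W' * ν k.succ (i k.succ) = min W W' * (n00 * ν k.succ (i k.succ)) by ring,
            min_mul_of_nonneg _ _ (mul_nonneg hn00pos.le (hν0 _ _).le)]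
  -- assemble
  have hsum := sum_le_sum hpt
  rw [← sum_mul, ← sum_mul, ← mul_sum, hF, mul_assoc, hFm] at hsum
  -- `ρ·(n00·min{W,W'}) ≤ S·n00`
  have : ρ * min W W' * n00 ≤ (∑ x ∈ block (fun z : Fin (K + 1) → S => mode ∘ z) i,
      min (tensorFun μ x) (tensorFun μ (x ∘ Equiv.swap (0 : Fin (K + 1)) k.succ))) * n00 := by
    calc ρ * min W W' * n00 = ρ * (n00 * min W W') := by ring
      _ ≤ _ := hsum
  exact le_of_mul_le_mul_right this hn00pos

/-! ## §2 The transported covering ratio (sector-preserving maps on the hub edges) -/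

omit [DecidableEq S] [Fintype J] in
/-- **THE TRANSPORTED COVERING RATIO GIVES THE MAP-ASSISTED HUB-SWAP OVERLAP:** for sector-preserving bijections
`φ_k` and `ρ ≥ 0` with `ρ·μ_0(u)·μ_{k+1}(A_{mode u}) ≤ μ_{k+1}(φ_k u)·μ_0(A_{mode u})` (the transported cold conditional
law covers the hot one up to `ρ`): `ρ·min{π̃(B_i), π̃(B_{i∘τ_k})} ≤ Σ_{y∈B_i} min{π̃(y), π̃(edgeFlowSwap φ_k 0 (k+1) y)}`.
[ours] -/
theorem flowHubModeOverlap_of_cover (φ : Fin K → Equiv.Perm S) (hφmode : ∀ (k : Fin K) (u : S), mode (φ k u) = mode u)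
    (hμ : ∀ k x, 0 < μ k x) (hmode : Function.Surjective mode) {ρ : ℝ} (hρ : 0 ≤ ρ)
    (hcov : ∀ (k : Fin K) (u : S),
      ρ * (μ 0 u * blockMass (μ k.succ) mode (mode u)) ≤ μ k.succ (φ k u) * blockMass (μ 0) mode (mode u))
    (i : Fin (K + 1) → J) (k : Fin K) :
    ρ * min (blockMass (tensorFun μ) (fun z : Fin (K + 1) → S => mode ∘ z) i)
        (blockMass (tensorFun μ) (fun z : Fin (K + 1) → S => mode ∘ z) (i ∘ Equiv.swap (0 : Fin (K + 1)) k.succ))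
      ≤ ∑ y ∈ block (fun z : Fin (K + 1) → S => mode ∘ z) i,
          min (tensorFun μ y) (tensorFun μ (edgeFlowSwap (φ k) 0 k.succ y)) := by
  set L : Fin (K + 1) → Equiv.Perm S := Fin.cons (Equiv.refl S) (fun k => (φ k).symm) with hL
  have hLmode : ∀ (i : Fin (K + 1)) (u : S), mode (L i u) = mode u := starLevel_mode φ hφmode
  have hLmode' : ∀ (i : Fin (K + 1)) (u : S), mode ((L i).symm u) = mode u := starLevel_symm_mode φ hφmode
  have hL0u : ∀ u, (L 0).symm u = u := fun u => by rw [hL, starLevel_zero]; rfl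
  have hLs : ∀ (k : Fin K) (u : S), (L k.succ).symm u = φ k u := fun k u => by rw [hL, starLevel_succ, Equiv.symm_symm]
  have hbm : ∀ (l : Fin (K + 1)) (j : J), blockMass (fun u => μ l ((L l).symm u)) mode j = blockMass (μ l) mode j :=
    fun l j => blockMass_relabel (L l).symm (hLmode' l) (μ l) j
  rw [← hubModeOverlap_relabel φ hφmode, ← blockMass_tensorFun_relabel L hLmode i,
    ← blockMass_tensorFun_relabel L hLmode (i ∘ Equiv.swap (0 : Fin (K + 1)) k.succ)]
  refine hubModeOverlap_of_cover (μ := fun l u => μ l ((L l).symm u)) (fun l u => hμ l _) hmode hρ ?_ i k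
  intro k' u
  rw [hbm k'.succ (mode u), hbm 0 (mode u), hL0u, hLs]
  exact hcov k' u

/-! ## §3 The balanced map-assisted star under a covering ratio -/

/-- **THE BALANCED MAP-ASSISTED STAR UNDER A TRANSPORTED COVERING RATIO:** sector-preserving `φ_k`, balanced weights,
one-sided persistence `p`, within-sector `γ_A`, hot global `γ₀`, covering ratio `0 < ρ ≤ 1`:
`Gap(P^φ) ≥ p(1−t)γ_A·min{tρ, γ₀(1−t)}/(224K²)`. [ours] -/
theorem flowHubModeCover_spectralGap_ge [Nontrivial S] (φ : Fin K → Equiv.Perm S)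
    (hφmode : ∀ (k : Fin K) (u : S), mode (φ k u) = mode u)
    (hμ : ∀ k x, 0 < μ k x) (hμ1 : ∀ k, ∑ x, μ k x = 1) (hmode : Function.Surjective mode) (hK : 1 ≤ K)
    (hM : ∀ k, IsRowStochastic (M k)) (hMrev : ∀ k, DetailedBalance (μ k) (M k)) (ht0 : 0 < t) (ht1 : t < 1)
    {p ρ γ₀ γA : ℝ} (hp : 0 < p) (hp1 : p ≤ 1) (hρ0 : 0 < ρ) (hρ1 : ρ ≤ 1) (hγ₀ : 0 < γ₀) (hγA : 0 < γA)
    (hγA1 : γA ≤ 1)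
    (hpers : ∀ (k : Fin K) (j : J), p * blockMass (μ k.succ) mode j ≤ blockMass (μ 0) mode j)
    (hcov : ∀ (k : Fin K) (u : S),
      ρ * (μ 0 u * blockMass (μ k.succ) mode (mode u)) ≤ μ k.succ (φ k u) * blockMass (μ 0) mode (mode u))
    (hgap0 : ∀ h : S → ℝ, γ₀ * lawVariance (μ 0) h ≤ dirichletForm (μ 0) (M 0) h)
    (hgapA : ∀ k j, ∀ h : S → ℝ, γA * lawVariance (blockLaw (μ k) mode j) h
      ≤ dirichletForm (blockLaw (μ k) mode j) (restrictionChain (M k) mode) h) :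
    p * (1 - t) * γA * min (t * ρ) (γ₀ * (1 - t)) / (224 * K ^ 2)
      ≤ spectralGap (tensorFun μ) (fun x y : Fin (K + 1) → S =>
          t * ptGraphSwap μ (fun k : Fin K => ((0 : Fin (K + 1)), k.succ)) φ x y
            + (1 - t) * prodKernel (fun k : Fin (K + 1) => if k = 0 then (1 : ℝ) / 2 else 1 / (2 * K)) M x y) :=
  flowHubMode_spectralGap_ge φ hφmode hμ hμ1 hmode hK hM hMrev ht0 ht1 hp hp1 hρ0 hρ1 hγ₀ hγA hγA1 hpers
    (fun i k _ => flowHubModeOverlap_of_cover φ hφmode hμ hmode hρ0.le hcov i k) hgap0 hgapA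

/-- **PERFECT SECTOR-WISE CONDITIONAL TRANSPORTS:** if each `φ_k` carries every sector's hot conditional law onto the
same sector's cold conditional law — `μ_{k+1}(φ_k u)·μ_0(A_{mode u}) = μ_0(u)·μ_{k+1}(A_{mode u})` — then for ARBITRARY
cold conditional shapes and arbitrary (one-sidedly persistent) sector weights
`Gap(P^φ) ≥ p(1−t)γ_A·min{t, γ₀(1−t)}/(224K²)`. [ours] -/
theorem flowHubModePerfect_spectralGap_ge [Nontrivial S] (φ : Fin K → Equiv.Perm S)
    (hφmode : ∀ (k : Fin K) (u : S), mode (φ k u) = mode u)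
    (hμ : ∀ k x, 0 < μ k x) (hμ1 : ∀ k, ∑ x, μ k x = 1) (hmode : Function.Surjective mode) (hK : 1 ≤ K)
    (hM : ∀ k, IsRowStochastic (M k)) (hMrev : ∀ k, DetailedBalance (μ k) (M k)) (ht0 : 0 < t) (ht1 : t < 1)
    {p γ₀ γA : ℝ} (hp : 0 < p) (hp1 : p ≤ 1) (hγ₀ : 0 < γ₀) (hγA : 0 < γA) (hγA1 : γA ≤ 1)
    (hpers : ∀ (k : Fin K) (j : J), p * blockMass (μ k.succ) mode j ≤ blockMass (μ 0) mode j)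
    (hperf : ∀ (k : Fin K) (u : S),
      μ k.succ (φ k u) * blockMass (μ 0) mode (mode u) = μ 0 u * blockMass (μ k.succ) mode (mode u))
    (hgap0 : ∀ h : S → ℝ, γ₀ * lawVariance (μ 0) h ≤ dirichletForm (μ 0) (M 0) h)
    (hgapA : ∀ k j, ∀ h : S → ℝ, γA * lawVariance (blockLaw (μ k) mode j) h
      ≤ dirichletForm (blockLaw (μ k) mode j) (restrictionChain (M k) mode) h) :
    p * (1 - t) * γA * min t (γ₀ * (1 - t)) / (224 * K ^ 2)
      ≤ spectralGap (tensorFun μ) (fun x y : Fin (K + 1) → S =>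
          t * ptGraphSwap μ (fun k : Fin K => ((0 : Fin (K + 1)), k.succ)) φ x y
            + (1 - t) * prodKernel (fun k : Fin (K + 1) => if k = 0 then (1 : ℝ) / 2 else 1 / (2 * K)) M x y) := by
  have h := flowHubModeCover_spectralGap_ge (M := M) (t := t) φ hφmode hμ hμ1 hmode hK hM hMrev ht0 ht1 hp hp1
    one_pos le_rfl hγ₀ hγA hγA1 hpers (fun k u => by rw [one_mul, hperf k u]) hgap0 hgapA
  rw [mul_one] at h
  exact h

/-- **EVERY OBSERVABLE under a transported covering ratio:** hot update irreducible ⇒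
`τ_int(g) ≤ 224K²/(p(1−t)γ_A·min{tρ, γ₀(1−t)}) − ½`. [ours] -/
theorem flowHubModeCover_tauInt_le [Nontrivial S] (φ : Fin K → Equiv.Perm S)
    (hφmode : ∀ (k : Fin K) (u : S), mode (φ k u) = mode u)
    (hμ : ∀ k x, 0 < μ k x) (hμ1 : ∀ k, ∑ x, μ k x = 1) (hmode : Function.Surjective mode) (hK : 1 ≤ K)
    (hM : ∀ k, IsRowStochastic (M k)) (hMrev : ∀ k, DetailedBalance (μ k) (M k)) (hM0 : IsIrreducible (M 0))
    (ht0 : 0 < t) (ht1 : t < 1)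
    {p ρ γ₀ γA : ℝ} (hp : 0 < p) (hp1 : p ≤ 1) (hρ0 : 0 < ρ) (hρ1 : ρ ≤ 1) (hγ₀ : 0 < γ₀) (hγA : 0 < γA)
    (hγA1 : γA ≤ 1)
    (hpers : ∀ (k : Fin K) (j : J), p * blockMass (μ k.succ) mode j ≤ blockMass (μ 0) mode j)
    (hcov : ∀ (k : Fin K) (u : S),
      ρ * (μ 0 u * blockMass (μ k.succ) mode (mode u)) ≤ μ k.succ (φ k u) * blockMass (μ 0) mode (mode u))
    (hgap0 : ∀ h : S → ℝ, γ₀ * lawVariance (μ 0) h ≤ dirichletForm (μ 0) (M 0) h)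
    (hgapA : ∀ k j, ∀ h : S → ℝ, γA * lawVariance (blockLaw (μ k) mode j) h
      ≤ dirichletForm (blockLaw (μ k) mode j) (restrictionChain (M k) mode) h)
    {g : (Fin (K + 1) → S) → ℝ} (hg : 0 < lawVariance (tensorFun μ) g) :
    asympVar g (tensorFun μ) (fun x y : Fin (K + 1) → S =>
        t * ptGraphSwap μ (fun k : Fin K => ((0 : Fin (K + 1)), k.succ)) φ x y
          + (1 - t) * prodKernel (fun k : Fin (K + 1) => if k = 0 then (1 : ℝ) / 2 else 1 / (2 * K)) M x y)
      / (2 * lawVariance (tensorFun μ) g)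
      ≤ 224 * K ^ 2 / (p * (1 - t) * γA * min (t * ρ) (γ₀ * (1 - t))) - 1 / 2 :=
  flowHubMode_tauInt_le φ hφmode hμ hμ1 hmode hK hM hMrev hM0 ht0 ht1 hp hp1 hρ0 hρ1 hγ₀ hγA hγA1 hpers
    (fun i k _ => flowHubModeOverlap_of_cover φ hφmode hμ hmode hρ0.le hcov i k) hgap0 hgapA hg

end Cover

end Summit.Ventures.LatticeQCDFlow.Scaling

end
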